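import Summits.BirchSwinnertonDyer.BirchSwinnertonDyer.Theorems.PrintX10bBeyondCarrierOfMuPartStabilizedCoherentPair
import Summits.BirchSwinnertonDyer.BirchSwinnertonDyer.Theorems.PrintX9MuInequalityCoherentPairOfPrintCG
import Literature.NumberTheory.EllipticCurves.AnticyclotomicTowerSharpOfSplittingProofs
import Literature.NumberTheory.EllipticCurves.AnticyclotomicTowerSharpProofs
import HarnessLib

/-!
# Crux `BeyondCarrierDepthX10b` (stmt-BirchSwinnertonDyer-23055, PrintX10b aside r301), line «twins» — CENSUS OF RECORD after
# the shared μ-crux closed and Tower♯ became a theorem: the crux BY NAME from FOURTEEN cite-only print facts, nothing else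

HONEST FRAMING (cell `run/shared/lean/pub/bsd-print-x9/`, seat bsd-line-x10b-p1 LEAD g10, registered line «twins», skeleton v8
`Cruxes/BeyondCarrierDepthX10b/Lines/twins.lean` sha d9aa95dab226; D-0154 KEY row 10): THEOREMS ONLY, conditional glue
`--supports 23055`; nothing booked, nothing closed. «beyond-print theorem»: NO. BSD is not proved by any of this; no summit
statement is proved by this seat.

WHY. Skeleton v8 has six registered stubs. After 2026-08-29T00:00:46Z two of them changed status:
* s2c `stub_muPartStabilizedCoherentPair : HeegnerMuPartStabilized.MuPartStabilizedCoherentPair` — the cell's shared μ-item, the ONE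
  research statement of the crux — is now a KERNEL THEOREM MODULO THREE PRINT LEAVES: the shared deciding μ-crux
  `MuInequalityCoherentPairOfPrintCG` (stmt-BirchSwinnertonDyer-23428) closed (μ-LEAD x9-p1 g4, p680258:
  `HeegnerMuPartOfPrintCGClosed.muPartStabilizedCoherentPair_of_leaves : thm161 → thm411∃ → G-2.4 → MuPartStabilizedCoherentPair`,
  over the D1/S1/S2 lineages of rows 9/10);
* s_tw `stub_anticyclotomicTowerSharp` (Tower♯, `K_k ⊆ K[p^{k+1}]`, support item 27076) — is an unconditional TREE THEOREM:
  `Literature.NumberTheory.EllipticCurves.anticyclotomicTowerSharp` (x10b-p1-w2 g12, p681041) over the idèlic splitting statement p680643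
  and the local odd-`p` lemma p680094 (x9-p1-w4 g10); equivalently this seat's end piece p680687 (`AnticyclotomicTowerSharpOfSplittingProofs`:
  Cox Thm. 11.1 + Bauer + Krull–Galois) applied to p680643 — the `_of_splitting` form below keeps the splitting statement as the
  hypothesis `hsplit` to document that reduction.
So the census of record (p631498 `beyondCarrierDepthX10b_of_muPartStabilizedCoherentPair_of_namedFacts`: 12 cite-only facts + Tower♯ +
the μ-letter) becomes: **crux 23055 BY NAME ⟸ 14 cite-only PRINT facts** — ZERO research statements, ZERO classical stubs. The fourteen:
MZ26 Cor. 4.6 (`h46`, `3 ∤ h_K` frames only) · CGLS Thm. 4.1.1 in two typings (`hNV` torsion form, `h411` Kolyvagin-system form) ·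
CGLS Thm. 4.1.3 localized (`hCGLS`) · Howard Thm. 1.6.1 (`h161`) · Greenberg LNM 1716 Prop. 2.4 (`hCG`) · the pinned class-number-free
transfer inputs `h57` (Castella BDP) `h59gp` (YZ/BCS at good primes, inline) `h422` (BCS Prop. 4.2.2) `h513` (CGLS Thm. 5.1.3) `hC`
(newform level) `h331` (JSW Thm. 3.3.1) · `hChaL` (Cha 2005 Rmk. 25) · `hKo` (Kolyvagin Thm. A).

WHAT.
* `beyondCarrierDepthX10b_of_printLeaves_of_splitting (h46 hNV hCGLS h57 h59gp h422 h513 hC h331 hChaL hKo h161 h411 hCG) (hsplit) :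
  BeyondCarrierDepthX10b` := p631498 ∘ (`anticyclotomicTowerSharp_of_forall_splitPrimes hsplit`) ∘
  (`muPartStabilizedCoherentPair_of_leaves h161 h411 hCG`).
* **`beyondCarrierDepthX10b_of_printLeaves (h46 hNV hCGLS h57 h59gp h422 h513 hC h331 hChaL hKo h161 h411 hCG) : BeyondCarrierDepthX10b`**
  — THE CENSUS OF RECORD: p631498 ∘ `anticyclotomicTowerSharp` ∘ `muPartStabilizedCoherentPair_of_leaves`.
References: as in `PrintX10bBeyondCarrierOfMuPartStabilizedCoherentPair.lean`, plus [Howard2004HeegnerKolyvagin] Thm. 1.6.1,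
[Greenberg1999] Prop. 2.4, [Cox2013] Thm. 7.24 / 9.2 / 11.1, [NeukirchANT1999] VII (13.9), [PerrinRiou1987BSMF] §3.2.
-/

-- the REGISTERED stub namespace `Summit.BirchSwinnertonDyer.BirchSwinnertonDyer.Cruxes.…` repeats the summit name
set_option linter.dupNamespace false
set_option autoImplicit false

noncomputable section

open scoped Classical Pointwise

open WeierstrassCurve NumberField IsDedekindDomain Field Literature.NumberTheory.EllipticCurves
  Literature.NumberTheory.EllipticCurves.ModularForms Literature.NumberTheory.EllipticCurves.Rank1Residual
  Literature.NumberTheory.EllipticCurves.Castella2018 Literature.NumberTheory.EllipticCurves.YanZhu2026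
  Literature.NumberTheory.EllipticCurves.CastellaGrossiLeeSkinner2022
  Literature.NumberTheory.EllipticCurves.JetchevSkinnerWan2017
open Literature.NumberTheory.NumberFields.RingClassField (primeClass)
open Literature.NumberTheory.GaloisRepresentations (splitPrimes)
open Summit.BirchSwinnertonDyer.Rank1Residual
open Summit.BirchSwinnertonDyer.BirchSwinnertonDyer.Theorems.HeegnerMuPartStabilized (MuPartStabilizedCoherentPair)
open Summit.BirchSwinnertonDyer.BirchSwinnertonDyer.Theses.PrintX10b (BeyondCarrierDepthX10b)

namespace Summit.BirchSwinnertonDyer.BirchSwinnertonDyer.Cruxes.BeyondCarrierDepthX10b.HowardFrames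

/-- **Crux `BeyondCarrierDepthX10b` BY NAME from fourteen cite-only print facts and one splitting statement** (census of
record of line «twins» after the shared μ-crux 23428 closed): `h46` MZ26 Cor. 4.6 (the `3 ∤ h_K` frames); `hNV`/`h411` CGLS
Thm. 4.1.1 (torsion typing / Kolyvagin-system typing), `hCGLS` CGLS Thm. 4.1.3, `h161` Howard Thm. 1.6.1, `hCG` Greenberg Prop. 2.4
(the `3 ∣ h_K` frames: the μ-letter `MuPartStabilizedCoherentPair` is the KERNEL theorem `muPartStabilizedCoherentPair_of_leaves`
of these three, p680258); the pinned transfer inputs `h57 h59gp h422 h513 hC h331`; the glue inputs `h331 hChaL hKo`; and `hsplit`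
— «all but finitely many primes of trivial ring class mod `p^{k+1}` split completely in the `k`-th anticyclotomic layer», from which
Tower♯ `K_k ⊆ K[p^{k+1}]` is the kernel theorem `anticyclotomicTowerSharp_of_forall_splitPrimes` (p680687). Composition:
p631498 `beyondCarrierDepthX10b_of_muPartStabilizedCoherentPair_of_namedFacts`. CONDITIONAL; credits nothing.
[cite: MastellaZerman2026, Cor. 4.6] [cite: CastellaGrossiLeeSkinner2022, Thm. 4.1.1, Thm. 4.1.3 and Thm. 5.1.3]
[cite: Howard2004HeegnerKolyvagin, Thm. 1.6.1 and Thm. 2.2.10 (proof)] [cite: Greenberg1999, Prop. 2.4]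
[cite: YanZhu2024MainConjNonCM, Thm. 5.7 (1), 5.9] [cite: BurungaleCastellaSkinner2025, Prop. 4.2.2]
[cite: JetchevSkinnerWan2017, Thm. 3.3.1] [cite: Cha2005, Rmk. 25] [cite: Kolyvagin1990, Thm. A]
[cite: Cox2013, §11.A Thm. 11.1 and §9.A Thm. 9.2] [cite: NeukirchANT1999, Ch. VII Prop. (13.9)] -/
theorem beyondCarrierDepthX10b_of_printLeaves_of_splitting
    (h46 : MastellaZerman2026.cor46_howardDivisibility_of_scalarImage.{0})
    (hNV : thm411_torsionFree_heegnerClass_ne_bot_quotient_isTorsion.{0})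
    (hCGLS : thm413_rankOne_charIdeal_torsion_dvd_localized.{0})
    (h57 : thm57_isTorsion_charIdealXGr_eq_bdpLFunction)
    (h59gp : ∀ {p : ℕ} [Fact p.Prime] (ι' : PadicAlgCl p ≃+* ℂ) (W : WeierstrassCurve ℚ) [W.IsElliptic]
      [W.IsGloballyMinimal] (K : Type) [Field K] [NumberField K] (v vbar : HeightOneSpectrum (𝓞 K))
      (κ : ZpExtension K p) (γ : absoluteGaloisGroup K) [Fact (κ.IsTopGenerator γ)] {N : ℕ} [NeZero N]
      {f : CuspForm (CongruenceSubgroup.Gamma0 N) 2} (jbar : AlgebraicClosure K →+* ℂ)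
      (_ : IsNewformOf W f),
      N = W.conductorNorm ℤ → 3 ≤ p → GoodOrd W p → (W.baseChange K).HasIrreducibleModPGaloisRep p →
      IsImaginaryQuadratic K → SatisfiesHeegnerHypothesis N K →
        ((Ideal.span {(p : ℤ)}).primesOver (𝓞 K)).ncard = 2 →
        Odd (NumberField.discr K) → NumberField.discr K ≠ -3 → κ.IsAnticyclotomic →
      (∀ (w : InfinitePlace K) (k : 𝓞 K), k ∈ v.asIdeal ↔ ‖ι'.symm (w.embedding (k : K))‖ < 1) →
        ((p : ℕ) : 𝓞 K) ∈ vbar.asIdeal → vbar ≠ v →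
      ∃ (ΩK : ℂ) (Ωp : (unrIntegers p)ˣ) (L : UnrSeries p),
        ΩK ≠ 0 ∧ IsBDPLFunction ι' v κ γ f ΩK ((Ωp : unrIntegers p) : ℂ_[p]) L ∧
        ∀ (D : (W.baseChange K).LambdaAdicSelmerData κ γ) (F : HeegnerFamily N W K κ jbar)
          (X : (W.baseChange K).SelmerDualData κ γ) (j : ℤ_[p] →+* unrIntegers p),
          ¬ (p : ℤ) ∣ F.Dt.c →
          (∀ x : ℤ_[p], ((j x : unrIntegers p) : ℂ_[p]) = algebraMap ℚ_[p] ℂ_[p] (x : ℚ_[p])) →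
          heegnerCharIdeal D F ^ 2 ≤
              Module.charIdeal (IwasawaAlgebra p) (Submodule.torsion (IwasawaAlgebra p) X.X) →
            L ∈ (AcSelmer.XAc.charIdeal (W.baseChange K) p κ vbar ∅ γ).map (PowerSeries.map j))
    (h422 : BurungaleCastellaSkinner2025.prop422_exists_isBDPLFunction_mu_eq_zero)
    (h513 : thm513_exists_isBDPLFunction_valueAtOne_disc)
    (hC : ∀ (N : ℕ) [NeZero N], IsNewformOf.level_eq_conductorNorm (N := N))
    (h331 : thm331_anticyclotomicControl)
    (hChaL : Cha2005.rmk25_pow_dvd_card_sha_primary_of_certificate)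
    (hKo : ∀ (N : ℕ) [NeZero N] (W : WeierstrassCurve ℚ) (K : Type) [Field K] [NumberField K],
      kolyvagin N W K)
    (h161 : Literature.NumberTheory.GaloisCohomology.Howard2004.thm161_dvrKolyvaginBound)
    (h411 : CastellaGrossiLeeSkinner2022.thm411_exists_kolyvaginSystem_one_ne_zero)
    (hCG : Greenberg1999.imKummer_eq_strictCondition_goodOrdinary_numberField)
    (hsplit : ∀ (K : Type) [Field K] [NumberField K] (p : ℕ) [Fact p.Prime], Odd p →
      IsImaginaryQuadratic K →
      ∀ (κ : ZpExtension K p), κ.IsAnticyclotomic → ∀ (k : ℕ),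
      ∀ᶠ v : HeightOneSpectrum (𝓞 K) in Filter.cofinite,
        primeClass (p ^ (k + 1)) v = 1 → v ∈ splitPrimes K (κ.layer k)) :
    BeyondCarrierDepthX10b :=
  beyondCarrierDepthX10b_of_muPartStabilizedCoherentPair_of_namedFacts h46 hNV hCGLS
    (anticyclotomicTowerSharp_of_forall_splitPrimes hsplit) h57 h59gp h422 h513 hC h331 hChaL hKo
    (Theorems.HeegnerMuPartOfPrintCGClosed.muPartStabilizedCoherentPair_of_leaves h161 h411 hCG)

/-- **CENSUS OF RECORD — crux `BeyondCarrierDepthX10b` BY NAME from fourteen cite-only print facts, nothing else**: `h46` MZ26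
Cor. 4.6 · `hNV`/`h411` CGLS Thm. 4.1.1 (two typings) · `hCGLS` CGLS Thm. 4.1.3 · `h161` Howard Thm. 1.6.1 · `hCG` Greenberg Prop. 2.4 ·
`h57` `h59gp` `h422` `h513` `hC` `h331` (pinned transfer) · `hChaL` Cha Rmk. 25 · `hKo` Kolyvagin Thm. A. The μ-part is the kernel theorem
`muPartStabilizedCoherentPair_of_leaves` (p680258, shared μ-crux 23428 CLOSED), the tower clause the kernel theorem
`anticyclotomicTowerSharp` (p681041). What is NOT proved: any of the fourteen leaves; the crux unconditionally; BSD. CONDITIONAL;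
credits nothing. [cite: MastellaZerman2026, Cor. 4.6] [cite: CastellaGrossiLeeSkinner2022, Thm. 4.1.1, Thm. 4.1.3 and Thm. 5.1.3]
[cite: Howard2004HeegnerKolyvagin, Thm. 1.6.1 and Thm. 2.2.10 (proof)] [cite: Greenberg1999, Prop. 2.4]
[cite: YanZhu2024MainConjNonCM, Thm. 5.7 (1), 5.9] [cite: BurungaleCastellaSkinner2025, Prop. 4.2.2]
[cite: JetchevSkinnerWan2017, Thm. 3.3.1] [cite: Cha2005, Rmk. 25] [cite: Kolyvagin1990, Thm. A]
[cite: Cox2013, §7.D Thm. 7.24 and §11.A Thm. 11.1] [cite: PerrinRiou1987BSMF, §3.2] -/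
theorem beyondCarrierDepthX10b_of_printLeaves
    (h46 : MastellaZerman2026.cor46_howardDivisibility_of_scalarImage.{0})
    (hNV : thm411_torsionFree_heegnerClass_ne_bot_quotient_isTorsion.{0})
    (hCGLS : thm413_rankOne_charIdeal_torsion_dvd_localized.{0})
    (h57 : thm57_isTorsion_charIdealXGr_eq_bdpLFunction)
    (h59gp : ∀ {p : ℕ} [Fact p.Prime] (ι' : PadicAlgCl p ≃+* ℂ) (W : WeierstrassCurve ℚ) [W.IsElliptic]
      [W.IsGloballyMinimal] (K : Type) [Field K] [NumberField K] (v vbar : HeightOneSpectrum (𝓞 K))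
      (κ : ZpExtension K p) (γ : absoluteGaloisGroup K) [Fact (κ.IsTopGenerator γ)] {N : ℕ} [NeZero N]
      {f : CuspForm (CongruenceSubgroup.Gamma0 N) 2} (jbar : AlgebraicClosure K →+* ℂ)
      (_ : IsNewformOf W f),
      N = W.conductorNorm ℤ → 3 ≤ p → GoodOrd W p → (W.baseChange K).HasIrreducibleModPGaloisRep p →
      IsImaginaryQuadratic K → SatisfiesHeegnerHypothesis N K →
        ((Ideal.span {(p : ℤ)}).primesOver (𝓞 K)).ncard = 2 →
        Odd (NumberField.discr K) → NumberField.discr K ≠ -3 → κ.IsAnticyclotomic →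
      (∀ (w : InfinitePlace K) (k : 𝓞 K), k ∈ v.asIdeal ↔ ‖ι'.symm (w.embedding (k : K))‖ < 1) →
        ((p : ℕ) : 𝓞 K) ∈ vbar.asIdeal → vbar ≠ v →
      ∃ (ΩK : ℂ) (Ωp : (unrIntegers p)ˣ) (L : UnrSeries p),
        ΩK ≠ 0 ∧ IsBDPLFunction ι' v κ γ f ΩK ((Ωp : unrIntegers p) : ℂ_[p]) L ∧
        ∀ (D : (W.baseChange K).LambdaAdicSelmerData κ γ) (F : HeegnerFamily N W K κ jbar)
          (X : (W.baseChange K).SelmerDualData κ γ) (j : ℤ_[p] →+* unrIntegers p),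
          ¬ (p : ℤ) ∣ F.Dt.c →
          (∀ x : ℤ_[p], ((j x : unrIntegers p) : ℂ_[p]) = algebraMap ℚ_[p] ℂ_[p] (x : ℚ_[p])) →
          heegnerCharIdeal D F ^ 2 ≤
              Module.charIdeal (IwasawaAlgebra p) (Submodule.torsion (IwasawaAlgebra p) X.X) →
            L ∈ (AcSelmer.XAc.charIdeal (W.baseChange K) p κ vbar ∅ γ).map (PowerSeries.map j))
    (h422 : BurungaleCastellaSkinner2025.prop422_exists_isBDPLFunction_mu_eq_zero)
    (h513 : thm513_exists_isBDPLFunction_valueAtOne_disc)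
    (hC : ∀ (N : ℕ) [NeZero N], IsNewformOf.level_eq_conductorNorm (N := N))
    (h331 : thm331_anticyclotomicControl)
    (hChaL : Cha2005.rmk25_pow_dvd_card_sha_primary_of_certificate)
    (hKo : ∀ (N : ℕ) [NeZero N] (W : WeierstrassCurve ℚ) (K : Type) [Field K] [NumberField K],
      kolyvagin N W K)
    (h161 : Literature.NumberTheory.GaloisCohomology.Howard2004.thm161_dvrKolyvaginBound)
    (h411 : CastellaGrossiLeeSkinner2022.thm411_exists_kolyvaginSystem_one_ne_zero)
    (hCG : Greenberg1999.imKummer_eq_strictCondition_goodOrdinary_numberField) :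
    BeyondCarrierDepthX10b :=
  beyondCarrierDepthX10b_of_muPartStabilizedCoherentPair_of_namedFacts h46 hNV hCGLS
    anticyclotomicTowerSharp h57 h59gp h422 h513 hC h331 hChaL hKo
    (Theorems.HeegnerMuPartOfPrintCGClosed.muPartStabilizedCoherentPair_of_leaves h161 h411 hCG)

end Summit.BirchSwinnertonDyer.BirchSwinnertonDyer.Cruxes.BeyondCarrierDepthX10b.HowardFrames

end
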